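import Summits.BirchSwinnertonDyer.BirchSwinnertonDyer.Theorems.GenusKolyvaginAtTwoPowDvdShaCardAtTwoRTInvariantRung
import Literature.NumberTheory.EllipticCurves.ArchimedeanLocalConditionTorsion
import HarnessLib

/-!
# Route `GenusKolyvaginAtTwo`, LINES 18/19 (`PowDvdShaCardAtTwoRT` stmt-BirchSwinnertonDyer-23242, `PowDvdShaCardAtTwoPosT` stmt-23379),
# stub 3a⁗ — TOOLBOX: the ONE-BIT RUNG FOR EITHER SIGN OF `Δ` AND EITHER EIGENSIGN (the rank-zero member may be `E` or its twist)

Seat `bsd-line-gk2-p1` g14 (LEAD seat 1/3, cell `bsd-f1-sign2`), `--supports stmt-BirchSwinnertonDyer-23242 --as helper`; sequel of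
`…RTRelaxedRung` (§5: `Δ < 0`) and `…RTInvariantRung` (`τ`-INVARIANT classes, `Δ < 0`).  THEOREMS ONLY (no definition, no named
fact, no `sorry`).  Nothing here closes an item; BSD is not proved by any of this.

Two generalisations needed by the frames: (i) the sign of `Δ` is IRRELEVANT for the one-bit descent — at a real place `H¹(ℝ, ·)` is killed
by `2` (`WeierstrassCurve.two_nsmul_mem_selmerLocalKer_infinitePlace`), so `res u ∈ Sel^{(n)}(E_K/K) ⟹ 2u ∈ Sel^{(n)}(E/ℚ)` holds for EVERY
`E/ℚ` and every quadratic `K` (LINE 19, `Δ > 0`, gets the same rung); (ii) the frames of L_T / L⁺_T do not say WHICH member of the pair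
`(E, E^{(d_K)})` has rank `0` (that is the root number `w(E)`): for `w(E) = −1` the odd-depth Kolyvagin classes are `τ`-ANTI-invariant
(`KolyvaginClassSign.sign_conjAct_kolyvaginClass_two`) and descend to the TWIST `E^{(c)}` through gk2-p3's
`EigenClassesFinite.existsUnique_hPsiKT_resTorsion_eq_of_conjAct_eq_neg`, where the same rung applies.

* §1 `two_zsmul_mem_selmerGroup_of_resTorsion_mem_anySign`, `two_zsmul_mem_selmerGroup_twist_of_hPsiKT_resTorsion_mem_anySign` —
  one-bit descent to `E` resp. `E^{(c)}`, no sign hypothesis.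
* §2 `two_mul_sub_one_le_padicValNat_sha_of_resTorsion_mem_anySign` (member `E`), `…_twist_of_hPsiKT_resTorsion_mem_anySign` (member `E^{(c)}`):
  rank `0` + odd torsion on the relevant member, `res`-Selmer class of order `2^a` ⟹ `2(a−1) ≤ ord₂ #Ш(member/ℚ)[2^∞]`.
* §3 K-side entry points: **`two_mul_sub_one_le_padicValNat_sha_of_invariant_selmer_class_anySign`** (`τ·y = y` ⟹ bound for `Ш(E/ℚ)`) and
  **`two_mul_sub_one_le_padicValNat_sha_twist_of_antiInvariant_selmer_class`** (`τ·y = −y` ⟹ bound for `Ш(E^{(c)}/ℚ)`), `y ∈ Sel^{(2^M)}(E_K/K)`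
  of order `2^a`, `ρ̄_{E,2}` onto, `[K : ℚ] = 2`.

References: [McCallumLMS1991] §4 Lemma 4.3, §5 p. 310; [GrossLMS1991] §5 (5.1), Prop. 5.4; [Kolyvagin1989Izv] §3 (the pair `(E, E^D)`);
[SerreGaloisCohomology1997] I §2.4.
-/

noncomputable section

-- `Summit.<P>.<Sub>` repeats `BirchSwinnertonDyer` by the tree's layout convention (D-0017)
set_option linter.dupNamespace false

open scoped Classical

namespace Summit.BirchSwinnertonDyer.BirchSwinnertonDyer.Theorems.GenusExact.PlusDescent

open _root_.WeierstrassCurve AddSubgroup NumberField Literature.NumberTheory.EllipticCurves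

variable (W : WeierstrassCurve ℚ) {K : Type} [Field K] [NumberField K]

/-! ## §1 One-bit descent, any sign of `Δ`, both members -/

/-- **One-bit descent to `E`, no sign hypothesis**: `[K : ℚ] = 2`, `res u ∈ Sel^{(n)}(E_K/K) ⟹ 2u ∈ Sel^{(n)}(E/ℚ)` (finite places:
gk2-p3's `SelmerDescent.two_zsmul_mem_selmerLocalKer_of_K`; infinite places: `H¹(ℝ, ·)` is `2`-torsion).
[cite: McCallumLMS1991, §4 Lemma 4.3] [cite: SerreGaloisCohomology1997, I §2.4 (Cor. to Prop. 9)] -/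
theorem two_zsmul_mem_selmerGroup_of_resTorsion_mem_anySign (h2 : Module.finrank ℚ K = 2) (n : ℤ)
    {u : galH1Torsion W n} (hu : resTorsion W K n u ∈ selmerGroup (W.baseChange K) n) :
    (2 : ℤ) • u ∈ selmerGroup W n := by
  rw [mem_selmerGroup_iff] at hu ⊢
  refine ⟨fun v ↦ GenusExact.SelmerDescent.two_zsmul_mem_selmerLocalKer_of_K W h2 n rfl v (fun w _ ↦ hu.1 w), fun w ↦ ?_⟩
  rw [two_zsmul, ← two_nsmul]
  exact two_nsmul_mem_selmerLocalKer_infinitePlace W n w u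

/-- **One-bit descent to the twist `E^{(c)}`, no sign hypothesis** (`K = ℚ(θ)`, `θ² = c`):
`hPsiKT (res y) ∈ Sel^{(n)}(E_K/K) ⟹ 2y ∈ Sel^{(n)}(E^{(c)}/ℚ)`. [cite: McCallumLMS1991, §4 Lemma 4.3] [cite: Kolyvagin1989Izv, §3] -/
theorem two_zsmul_mem_selmerGroup_twist_of_hPsiKT_resTorsion_mem_anySign (h2 : Module.finrank ℚ K = 2) {θ : K} {c : ℚ}
    (hθ : θ ∉ Set.range (algebraMap ℚ K)) (hc : θ ^ 2 = algebraMap ℚ K c) (n : ℤ)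
    {y : galH1Torsion (W.quadraticTwist c) n}
    (hy : hPsiKT W K hθ hc n (resTorsion (W.quadraticTwist c) K n y) ∈ selmerGroup (W.baseChange K) n) :
    (2 : ℤ) • y ∈ selmerGroup (W.quadraticTwist c) n := by
  rw [mem_selmerGroup_iff] at hy
  rw [mem_selmerGroup_iff]
  refine ⟨fun v ↦ GenusExact.SelmerDescent.two_zsmul_mem_selmerLocalKer_twin_of_K W h2 hθ hc n rfl v (fun w _ ↦ hy.1 w),
    fun w ↦ ?_⟩
  rw [two_zsmul, ← two_nsmul]
  exact two_nsmul_mem_selmerLocalKer_infinitePlace (W.quadraticTwist c) n w y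

/-! ## §2 The one-bit rung on either member, any sign of `Δ` -/

/-- **One-bit rung, member `E`, any sign of `Δ`**: `W/ℚ` elliptic with `rank E(ℚ) = 0` and odd `#E(ℚ)_tors`, `[K : ℚ] = 2`,
`Ш(E/ℚ)[2^∞]` finite; `res c ∈ Sel^{(2^M)}(E_K/K)`, `ord c = 2^a` ⟹ `2(a−1) ≤ ord₂ #Ш(E/ℚ)[2^∞]`. [cite: McCallumLMS1991, §5 p. 310] -/
theorem two_mul_sub_one_le_padicValNat_sha_of_resTorsion_mem_anySign [W.IsElliptic] (h2 : Module.finrank ℚ K = 2)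
    (hrk : W.mordellWeilRank = 0) (htor : Odd W.torsionOrder) [Finite (AddCommGroup.primaryComponent W.sha 2)] (M : ℕ)
    {c : galH1Torsion W ((2 ^ M : ℕ) : ℤ)}
    (hc : resTorsion W K ((2 ^ M : ℕ) : ℤ) c ∈ selmerGroup (W.baseChange K) ((2 ^ M : ℕ) : ℤ))
    {a : ℕ} (hca : addOrderOf c = 2 ^ a) :
    2 * (a - 1) ≤ padicValNat 2 (Nat.card (AddCommGroup.primaryComponent W.sha 2)) := by
  have h2c : (2 ^ 1) • c ∈ selmerGroup W ((2 ^ M : ℕ) : ℤ) := by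
    rw [pow_one, two_nsmul, ← two_zsmul]
    exact two_zsmul_mem_selmerGroup_of_resTorsion_mem_anySign W h2 _ hc
  exact two_mul_sub_le_padicValNat_natCard_primaryComponent_sha_of_nsmul_mem_selmerGroup W M
    (exists_zsmul_two_pow_eq_of_rank_zero_of_odd_torsionOrder W hrk htor M) hca h2c

/-- **One-bit rung, member `E^{(c)}` (the twist), any sign of `Δ`**: `c ≠ 0`, `rank E^{(c)}(ℚ) = 0`, odd `#E^{(c)}(ℚ)_tors`,
`Ш(E^{(c)}/ℚ)[2^∞]` finite; `hPsiKT (res y) ∈ Sel^{(2^M)}(E_K/K)`, `ord y = 2^a` ⟹ `2(a−1) ≤ ord₂ #Ш(E^{(c)}/ℚ)[2^∞]`.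
[cite: McCallumLMS1991, §5 p. 310] [cite: Kolyvagin1989Izv, §3] -/
theorem two_mul_sub_one_le_padicValNat_sha_twist_of_hPsiKT_resTorsion_mem_anySign [W.IsElliptic]
    (h2 : Module.finrank ℚ K = 2) {θ : K} {c : ℚ} (hθ : θ ∉ Set.range (algebraMap ℚ K)) (hc : θ ^ 2 = algebraMap ℚ K c)
    (hc0 : c ≠ 0) (hrk : (W.quadraticTwist c).mordellWeilRank = 0) (htor : Odd (W.quadraticTwist c).torsionOrder)
    [Finite (AddCommGroup.primaryComponent (W.quadraticTwist c).sha 2)] (M : ℕ)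
    {y : galH1Torsion (W.quadraticTwist c) ((2 ^ M : ℕ) : ℤ)}
    (hy : hPsiKT W K hθ hc ((2 ^ M : ℕ) : ℤ) (resTorsion (W.quadraticTwist c) K ((2 ^ M : ℕ) : ℤ) y) ∈
      selmerGroup (W.baseChange K) ((2 ^ M : ℕ) : ℤ))
    {a : ℕ} (hya : addOrderOf y = 2 ^ a) :
    2 * (a - 1) ≤ padicValNat 2 (Nat.card (AddCommGroup.primaryComponent (W.quadraticTwist c).sha 2)) := by
  haveI := W.isElliptic_quadraticTwist hc0
  have h2y : (2 ^ 1) • y ∈ selmerGroup (W.quadraticTwist c) ((2 ^ M : ℕ) : ℤ) := by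
    rw [pow_one, two_nsmul, ← two_zsmul]
    exact two_zsmul_mem_selmerGroup_twist_of_hPsiKT_resTorsion_mem_anySign W h2 hθ hc _ hy
  exact two_mul_sub_le_padicValNat_natCard_primaryComponent_sha_of_nsmul_mem_selmerGroup (W.quadraticTwist c) M
    (exists_zsmul_two_pow_eq_of_rank_zero_of_odd_torsionOrder (W.quadraticTwist c) hrk htor M) hya h2y

/-! ## §3 K-side entry points: `τ`-eigen Selmer classes over `K`, either eigensign -/

/-- **Invariant class ⟹ bound for `Ш(E/ℚ)`, any sign of `Δ`**: `ρ̄_{E,2}` onto, `[K : ℚ] = 2`, `τ ≠ 1`, `rank E(ℚ) = 0`, `Ш(E/ℚ)[2^∞]`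
finite; `y ∈ Sel^{(2^M)}(E_K/K)`, `τ·y = y`, `ord y = 2^a` ⟹ `2(a−1) ≤ ord₂ #Ш(E/ℚ)[2^∞]` (case `w(E) = +1` of the odd-depth classes).
[cite: GrossLMS1991, §5 (5.1) and Prop. 5.4] [cite: McCallumLMS1991, §5 p. 310] -/
theorem two_mul_sub_one_le_padicValNat_sha_of_invariant_selmer_class_anySign [W.IsElliptic] (h2 : Module.finrank ℚ K = 2)
    (hρ : W.HasSurjectiveModNGaloisRep 2) (hrk : W.mordellWeilRank = 0) [Finite (AddCommGroup.primaryComponent W.sha 2)]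
    (τ : K ≃ₐ[ℚ] K) (hτ : τ ≠ 1) (M : ℕ) {y : galH1Torsion (W.baseChange K) ((2 ^ M : ℕ) : ℤ)}
    (hy : y ∈ selmerGroup (W.baseChange K) ((2 ^ M : ℕ) : ℤ)) (hτy : conjAct W τ ((2 ^ M : ℕ) : ℤ) y = y)
    {a : ℕ} (hya : addOrderOf y = 2 ^ a) :
    2 * (a - 1) ≤ padicValNat 2 (Nat.card (AddCommGroup.primaryComponent W.sha 2)) := by
  obtain ⟨θ, hθ, hθsq⟩ := Literature.NumberTheory.QuadraticFields.Quadratic.exists_not_mem_range_sq_eq_discr (K := K) h2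
  have hL := GenusExact.EigenClassesFinite.forall_zsmul_two_pow_baseChange_eq_zero_of_hasSurjectiveModNGaloisRep_two W K h2
    hρ M
  have hστ : τ = sigmaQ K h2 hθ hθsq := eq_sigmaQ_of_ne_one K h2 τ hτ hθ hθsq
  rw [hστ] at hτy
  obtain ⟨c, hc, -⟩ :=
    GenusExact.EigenClassesFinite.existsUnique_resTorsion_eq_of_conjAct_eq W K h2 hθ hθsq _ hL hτy
  have hinj := GenusExact.EigenClassesFinite.resTorsion_injective_of_noTorsion W K h2 hθ hθsq ((2 ^ M : ℕ) : ℤ) hL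
  have hca : addOrderOf c = 2 ^ a := by rw [← addOrderOf_injective _ hinj c, hc, hya]
  exact two_mul_sub_one_le_padicValNat_sha_of_resTorsion_mem_anySign W h2 hrk
    (odd_torsionOrder_of_hasSurjectiveModNGaloisRep_two W hρ) M (by rw [hc]; exact hy) hca

/-- **Anti-invariant class ⟹ bound for `Ш(E^{(c)}/ℚ)`** (the twist member; case `w(E) = −1` of the odd-depth classes, or the
even-depth classes for `w(E) = +1`): `ρ̄_{E,2}` onto, `K = ℚ(θ)` with `θ² = c ≠ 0`, `rank E^{(c)}(ℚ) = 0` with odd `#E^{(c)}(ℚ)_tors`,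
`Ш(E^{(c)}/ℚ)[2^∞]` finite; `y ∈ Sel^{(2^M)}(E_K/K)`, `σ₀·y = −y`, `ord y = 2^a` ⟹ `2(a−1) ≤ ord₂ #Ш(E^{(c)}/ℚ)[2^∞]`.
[cite: GrossLMS1991, §5 (5.1) and Prop. 5.4] [cite: Kolyvagin1989Izv, §3] [cite: McCallumLMS1991, §5 p. 310] -/
theorem two_mul_sub_one_le_padicValNat_sha_twist_of_antiInvariant_selmer_class [W.IsElliptic] (h2 : Module.finrank ℚ K = 2)
    {θ : K} {c : ℚ} (hθ : θ ∉ Set.range (algebraMap ℚ K)) (hc : θ ^ 2 = algebraMap ℚ K c) (hc0 : c ≠ 0)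
    (hρ : W.HasSurjectiveModNGaloisRep 2) (hrk : (W.quadraticTwist c).mordellWeilRank = 0)
    (htor : Odd (W.quadraticTwist c).torsionOrder) [Finite (AddCommGroup.primaryComponent (W.quadraticTwist c).sha 2)]
    (M : ℕ) {y : galH1Torsion (W.baseChange K) ((2 ^ M : ℕ) : ℤ)}
    (hy : y ∈ selmerGroup (W.baseChange K) ((2 ^ M : ℕ) : ℤ))
    (hσy : conjAct W (sigmaQ K h2 hθ hc) ((2 ^ M : ℕ) : ℤ) y = -y)
    {a : ℕ} (hya : addOrderOf y = 2 ^ a) :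
    2 * (a - 1) ≤ padicValNat 2 (Nat.card (AddCommGroup.primaryComponent (W.quadraticTwist c).sha 2)) := by
  have hL := GenusExact.EigenClassesFinite.forall_zsmul_two_pow_baseChange_eq_zero_of_hasSurjectiveModNGaloisRep_two W K h2
    hρ M
  obtain ⟨x, hx, -⟩ :=
    GenusExact.EigenClassesFinite.existsUnique_hPsiKT_resTorsion_eq_of_conjAct_eq_neg W K h2 hθ hc _ hL hσy
  have hinj : Function.Injective (fun z : galH1Torsion (W.quadraticTwist c) ((2 ^ M : ℕ) : ℤ) ↦
      hPsiKT W K hθ hc ((2 ^ M : ℕ) : ℤ) (resTorsion (W.quadraticTwist c) K ((2 ^ M : ℕ) : ℤ) z)) :=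
    (hPsiKT W K hθ hc _).injective.comp
      (GenusExact.EigenClassesFinite.resTorsion_twist_injective_of_noTorsion W K h2 hθ hc _ hL)
  have hxa : addOrderOf x = 2 ^ a := by
    have := addOrderOf_injective
      ((hPsiKT W K hθ hc ((2 ^ M : ℕ) : ℤ)).toAddMonoidHom.comp (resTorsion (W.quadraticTwist c) K ((2 ^ M : ℕ) : ℤ)))
      hinj x
    rw [← hya, ← hx, ← this]
    rfl
  exact two_mul_sub_one_le_padicValNat_sha_twist_of_hPsiKT_resTorsion_mem_anySign W h2 hθ hc hc0 hrk htor M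
    (by rw [hx]; exact hy) hxa

end Summit.BirchSwinnertonDyer.BirchSwinnertonDyer.Theorems.GenusExact.PlusDescent

end
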